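import Summits.Ventures.YMGap.Thresholds.BallCertificateTwo
import Summits.Ventures.YMGap.Thresholds.BallPieceThreeA
import Summits.Ventures.YMGap.Thresholds.BallPieceThreeB
import Summits.Ventures.YMGap.Thresholds.BallPieceThreeC
import Summits.Ventures.YMGap.Thresholds.BallPieceThreeD
import Summits.Ventures.YMGap.Thresholds.BallPieceThreeE
import Summits.Ventures.YMGap.Thresholds.BallPieceThreeF
import Summits.Ventures.YMGap.Thresholds.BallPieceThreeG
import Summits.Ventures.YMGap.Thresholds.BallPieceThreeH
import Summits.Ventures.YMGap.Thresholds.BallPieceThreeI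
import Summits.Ventures.YMGap.Thresholds.BallPieceThreeJ
import HarnessLib

/-!
# The ball-flux certificate, rung 1/2: the certificate on `0 < κ ≤ 3` assembled from `ball_certificate2` (`κ ≤ 2`)
and the ten certified pieces covering `(2, 3]` (pub-ymgap track (a), A4-K kernel port) — no mass-gap claim

HONEST FRAMING. Kernel bookkeeping: `ball_certificate3` has the statement of the tree's `ball_certificate127` with
`12/7 ↦ 3` (one-link laws with `‖B‖_op ≤ 3/4`, Wilson `β_W ≤ 1/2` on the slab door); below `2` it IS
`ball_certificate2`; on `(2, 3]` it is engine-2's certified pieces `BallPieceThreeA … J` (cell pub-ymgap,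
`pub-ymgap-engine-2/A4K-CERT.md`, generator `leanwork/gen_cert_three.py`).  Also `brackets3`: the facts `1 ≤ Z`,
`1/4 ≤ z_B`, `z_B < Z/4` on `(2, 3]` from the pieces' cancellation brackets (input of the covariance file).  Elementary real
arithmetic; no statement about lattice measures, confinement or the mass gap; no number of any ledger moves here.
-/

noncomputable section

open MeasureTheory Filter Finset Real intervalIntegral
open scoped NNReal Quaternion Matrix BigOperators Topology Nat
open Matrix Complex
open Literature.MathematicalPhysics.QuantumLattice (su2Quat)
open Literature.MathematicalPhysics.QuantumFieldTheory
open Summit.Ventures.YMGap.BallBracketsThree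
open Summit.Ventures.YMGap.BallCertificateTwo (ball_certificate2)
open Summit.Ventures.YMGap.BallPieceThreeA (piece_brackets_qa cancel_piece_qa cert_arith_qa)
open Summit.Ventures.YMGap.BallPieceThreeB (piece_brackets_qb cancel_piece_qb cert_arith_qb)
open Summit.Ventures.YMGap.BallPieceThreeC (piece_brackets_qc cancel_piece_qc cert_arith_qc)
open Summit.Ventures.YMGap.BallPieceThreeD (piece_brackets_qd cancel_piece_qd cert_arith_qd)
open Summit.Ventures.YMGap.BallPieceThreeE (piece_brackets_qe cancel_piece_qe cert_arith_qe)
open Summit.Ventures.YMGap.BallPieceThreeF (piece_brackets_qf cancel_piece_qf cert_arith_qf)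
open Summit.Ventures.YMGap.BallPieceThreeG (piece_brackets_qg cancel_piece_qg cert_arith_qg)
open Summit.Ventures.YMGap.BallPieceThreeH (piece_brackets_qh cancel_piece_qh cert_arith_qh)
open Summit.Ventures.YMGap.BallPieceThreeI (piece_brackets_qi cancel_piece_qi cert_arith_qi)
open Summit.Ventures.YMGap.BallPieceThreeJ (piece_brackets_qj cancel_piece_qj cert_arith_qj)

namespace Summit.Ventures.YMGap.BallCertificateThree

/-- **The rational brackets `1 ≤ Z`, `1/4 ≤ z_B < Z/4` on `2 < κ ≤ 3`** from the pieces' cancellation brackets. [folklore] -/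
theorem brackets3 {κ Z zB : ℝ} (h2 : 2 < κ) (hκ1 : κ ≤ 3)
    (hZ : Z = ∫ g : Matrix.specialUnitaryGroup (Fin 2) ℂ, Real.exp (κ * (su2Quat g).re) ∂(haarProbability (Matrix.specialUnitaryGroup (Fin 2) ℂ)))
    (hzB : zB = ∫ r in (0:ℝ)..1, r ^ 3 * ∫ g : Matrix.specialUnitaryGroup (Fin 2) ℂ, Real.exp (κ * r * (su2Quat g).re) ∂(haarProbability (Matrix.specialUnitaryGroup (Fin 2) ℂ))) :
    1 ≤ Z ∧ 1 / 4 ≤ zB ∧ zB < Z / 4 := by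
  have hκ : 0 ≤ κ := by linarith
  obtain ⟨hZl, hZu⟩ := Z_bracket3 hκ hκ1
  obtain ⟨hZpl, hZpu⟩ := Zp_bracket3 hκ hκ1
  obtain ⟨hBl, hBu⟩ := zB_bracket3 hκ hκ1
  rw [← hZ] at hZl hZu
  rw [← hzB] at hBl hBu
  rcases le_or_gt κ (61 / 28) with hA | hA
  · have hb := cancel_piece_qa h2.le hA hZl hZu hZpl hZpu hBl hBu
    have hgap : 2127 / 10000 ≤ Z - 4 * zB := hb.2.2.2.2.2.2
    exact ⟨hb.1, hb.2.1, by linarith⟩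
  rcases le_or_gt κ (65 / 28) with hB | hB
  · have hb := cancel_piece_qb hA.le hB hZl hZu hZpl hZpu hBl hBu
    have hgap : 1319 / 5000 ≤ Z - 4 * zB := hb.2.2.2.2.2.2
    exact ⟨hb.1, hb.2.1, by linarith⟩
  rcases le_or_gt κ (69 / 28) with hC | hC
  · have hb := cancel_piece_qc hB.le hC hZl hZu hZpl hZpu hBl hBu
    have hgap : 3111 / 10000 ≤ Z - 4 * zB := hb.2.2.2.2.2.2
    exact ⟨hb.1, hb.2.1, by linarith⟩
  rcases le_or_gt κ (18 / 7) with hD | hD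
  · have hb := cancel_piece_qd hC.le hD hZl hZu hZpl hZpu hBl hBu
    have hgap : 3649 / 10000 ≤ Z - 4 * zB := hb.2.2.2.2.2.2
    exact ⟨hb.1, hb.2.1, by linarith⟩
  rcases le_or_gt κ (75 / 28) with hE | hE
  · have hb := cancel_piece_qe hD.le hE hZl hZu hZpl hZpu hBl hBu
    have hgap : 41 / 100 ≤ Z - 4 * zB := hb.2.2.2.2.2.2
    exact ⟨hb.1, hb.2.1, by linarith⟩
  rcases le_or_gt κ (11 / 4) with hF | hF
  · have hb := cancel_piece_qf hE.le hF hZl hZu hZpl hZpu hBl hBu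
    have hgap : 1149 / 2500 ≤ Z - 4 * zB := hb.2.2.2.2.2.2
    exact ⟨hb.1, hb.2.1, by linarith⟩
  rcases le_or_gt κ (79 / 28) with hG | hG
  · have hb := cancel_piece_qg hF.le hG hZl hZu hZpl hZpu hBl hBu
    have hgap : 4953 / 10000 ≤ Z - 4 * zB := hb.2.2.2.2.2.2
    exact ⟨hb.1, hb.2.1, by linarith⟩
  rcases le_or_gt κ (81 / 28) with hH | hH
  · have hb := cancel_piece_qh hG.le hH hZl hZu hZpl hZpu hBl hBu
    have hgap : 2667 / 5000 ≤ Z - 4 * zB := hb.2.2.2.2.2.2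
    exact ⟨hb.1, hb.2.1, by linarith⟩
  rcases le_or_gt κ (83 / 28) with hI | hI
  · have hb := cancel_piece_qi hH.le hI hZl hZu hZpl hZpu hBl hBu
    have hgap : 287 / 500 ≤ Z - 4 * zB := hb.2.2.2.2.2.2
    exact ⟨hb.1, hb.2.1, by linarith⟩
  have hb := cancel_piece_qj hI.le hκ1 hZl hZu hZpl hZpu hBl hBu
  have hgap : 6171 / 10000 ≤ Z - 4 * zB := hb.2.2.2.2.2.2
  exact ⟨hb.1, hb.2.1, by linarith⟩

/-- **The ball-flux certificate on the range `0 < κ ≤ 3`** — the statement of `ball_certificate127` ∕ `ball_certificate2`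
with the range extended to `3`; below `2`: `ball_certificate2`; on the ten pieces above: their `cert_arith`. [folklore] -/
theorem ball_certificate3 {κ Z Zp zB m2 J41 J52 J61 J72 J63 J74 : ℝ} (hκ0 : 0 < κ) (hκ1 : κ ≤ 3)
    (hZ : Z = ∫ g : Matrix.specialUnitaryGroup (Fin 2) ℂ, Real.exp (κ * (su2Quat g).re) ∂haarProbability (Matrix.specialUnitaryGroup (Fin 2) ℂ))
    (hZp : Zp = ∫ g : Matrix.specialUnitaryGroup (Fin 2) ℂ, (su2Quat g).re * Real.exp (κ * (su2Quat g).re)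
        ∂haarProbability (Matrix.specialUnitaryGroup (Fin 2) ℂ))
    (hzB : zB = ∫ r in (0:ℝ)..1, r ^ 3 * ∫ g : Matrix.specialUnitaryGroup (Fin 2) ℂ,
        Real.exp (κ * r * (su2Quat g).re) ∂haarProbability (Matrix.specialUnitaryGroup (Fin 2) ℂ))
    (hm2 : m2 = ∫ r in (0:ℝ)..1, r ^ 5 * ∫ g : Matrix.specialUnitaryGroup (Fin 2) ℂ,
        Real.exp (κ * r * (su2Quat g).re) ∂haarProbability (Matrix.specialUnitaryGroup (Fin 2) ℂ))
    (hJ41 : J41 = ∫ r in (0:ℝ)..1, r ^ 4 * ∫ g : Matrix.specialUnitaryGroup (Fin 2) ℂ,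
        (su2Quat g).re * Real.exp (κ * r * (su2Quat g).re) ∂haarProbability (Matrix.specialUnitaryGroup (Fin 2) ℂ))
    (hJ52 : J52 = ∫ r in (0:ℝ)..1, r ^ 5 * ∫ g : Matrix.specialUnitaryGroup (Fin 2) ℂ,
        (su2Quat g).re ^ 2 * Real.exp (κ * r * (su2Quat g).re) ∂haarProbability (Matrix.specialUnitaryGroup (Fin 2) ℂ))
    (hJ61 : J61 = ∫ r in (0:ℝ)..1, r ^ 6 * ∫ g : Matrix.specialUnitaryGroup (Fin 2) ℂ,
        (su2Quat g).re * Real.exp (κ * r * (su2Quat g).re) ∂haarProbability (Matrix.specialUnitaryGroup (Fin 2) ℂ))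
    (hJ72 : J72 = ∫ r in (0:ℝ)..1, r ^ 7 * ∫ g : Matrix.specialUnitaryGroup (Fin 2) ℂ,
        (su2Quat g).re ^ 2 * Real.exp (κ * r * (su2Quat g).re) ∂haarProbability (Matrix.specialUnitaryGroup (Fin 2) ℂ))
    (hJ63 : J63 = ∫ r in (0:ℝ)..1, r ^ 6 * ∫ g : Matrix.specialUnitaryGroup (Fin 2) ℂ,
        (su2Quat g).re ^ 3 * Real.exp (κ * r * (su2Quat g).re) ∂haarProbability (Matrix.specialUnitaryGroup (Fin 2) ℂ))
    (hJ74 : J74 = ∫ r in (0:ℝ)..1, r ^ 7 * ∫ g : Matrix.specialUnitaryGroup (Fin 2) ℂ,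
        (su2Quat g).re ^ 4 * Real.exp (κ * r * (su2Quat g).re) ∂haarProbability (Matrix.specialUnitaryGroup (Fin 2) ℂ)) :
    16 * m2 * ((κ * (1 - κ ^ 2 / 20) - 4 * (Zp / Z)) ^ 2 * zB
        + 2 * (κ * (1 - κ ^ 2 / 20) - 4 * (Zp / Z)) * (κ ^ 2 / 4 - κ * (Zp / Z)) * J41
        + ((κ ^ 2 / 4 - κ * (Zp / Z)) ^ 2 + 2 * (κ * (1 - κ ^ 2 / 20) - 4 * (Zp / Z)) * (κ ^ 3 / 20)) * J52
        + 2 * (κ ^ 2 / 4 - κ * (Zp / Z)) * (κ ^ 3 / 20) * J63 + (κ ^ 3 / 20) ^ 2 * J74) * zB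
      ≤ (Z ^ 2 - 16 * zB ^ 2) * (zB - ((1 - κ ^ 2 / 20) ^ 2 * zB + 2 * (1 - κ ^ 2 / 20) * (κ ^ 2 / 20) * J52
          - 2 * (1 - κ ^ 2 / 20) * (Zp / Z) * J41 + (κ ^ 2 / 20) ^ 2 * J72 - 2 * (κ ^ 2 / 20) * (Zp / Z) * J61
          + (Zp / Z) ^ 2 * m2)) := by
  rcases le_or_gt κ 2 with h2 | h2
  · exact ball_certificate2 hκ0 h2 hZ hZp hzB hm2 hJ41 hJ52 hJ61 hJ72 hJ63 hJ74
  have hκ : 0 ≤ κ := hκ0.le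
  obtain ⟨hZl, hZu⟩ := Z_bracket3 hκ hκ1
  obtain ⟨hZpl, hZpu⟩ := Zp_bracket3 hκ hκ1
  obtain ⟨hBl, hBu⟩ := zB_bracket3 hκ hκ1
  have hm2l : 0 ≤ ∫ r in (0:ℝ)..1, r ^ 5 * ∫ g : Matrix.specialUnitaryGroup (Fin 2) ℂ, Real.exp (κ * r * (su2Quat g).re) ∂(haarProbability (Matrix.specialUnitaryGroup (Fin 2) ℂ)) := by
    simpa using ball_nonneg3 0 5 hκ hκ1
  subst hZ hZp hzB hm2 hJ41 hJ52 hJ61 hJ72 hJ63 hJ74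
  rcases le_or_gt κ (61 / 28) with hA | hA
  · obtain ⟨b1, b2, b3, b4, b5, b6, b7, b8, b9, b10, b11, b12, b13, b14⟩ := piece_brackets_qa h2.le hA
    obtain ⟨-, -, c1, c2, c3, c4, c5⟩ := cancel_piece_qa h2.le hA hZl hZu hZpl hZpu hBl hBu
    exact cert_arith_qa h2.le hA b1 b2 b3 b4 b5 b6 hm2l b7 b8 b9 b10 b11 (ball_nonneg3 2 7 hκ hκ1) b12
      (ball_nonneg3 3 6 hκ hκ1) b13 (ball_nonneg3 4 7 hκ hκ1) b14 c1 c2 c3 c4 c5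
  rcases le_or_gt κ (65 / 28) with hB | hB
  · obtain ⟨b1, b2, b3, b4, b5, b6, b7, b8, b9, b10, b11, b12, b13, b14⟩ := piece_brackets_qb hA.le hB
    obtain ⟨-, -, c1, c2, c3, c4, c5⟩ := cancel_piece_qb hA.le hB hZl hZu hZpl hZpu hBl hBu
    exact cert_arith_qb hA.le hB b1 b2 b3 b4 b5 b6 hm2l b7 b8 b9 b10 b11 (ball_nonneg3 2 7 hκ hκ1) b12
      (ball_nonneg3 3 6 hκ hκ1) b13 (ball_nonneg3 4 7 hκ hκ1) b14 c1 c2 c3 c4 c5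
  rcases le_or_gt κ (69 / 28) with hC | hC
  · obtain ⟨b1, b2, b3, b4, b5, b6, b7, b8, b9, b10, b11, b12, b13, b14⟩ := piece_brackets_qc hB.le hC
    obtain ⟨-, -, c1, c2, c3, c4, c5⟩ := cancel_piece_qc hB.le hC hZl hZu hZpl hZpu hBl hBu
    exact cert_arith_qc hB.le hC b1 b2 b3 b4 b5 b6 hm2l b7 b8 b9 b10 b11 (ball_nonneg3 2 7 hκ hκ1) b12
      (ball_nonneg3 3 6 hκ hκ1) b13 (ball_nonneg3 4 7 hκ hκ1) b14 c1 c2 c3 c4 c5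
  rcases le_or_gt κ (18 / 7) with hD | hD
  · obtain ⟨b1, b2, b3, b4, b5, b6, b7, b8, b9, b10, b11, b12, b13, b14⟩ := piece_brackets_qd hC.le hD
    obtain ⟨-, -, c1, c2, c3, c4, c5⟩ := cancel_piece_qd hC.le hD hZl hZu hZpl hZpu hBl hBu
    exact cert_arith_qd hC.le hD b1 b2 b3 b4 b5 b6 hm2l b7 b8 b9 b10 b11 (ball_nonneg3 2 7 hκ hκ1) b12
      (ball_nonneg3 3 6 hκ hκ1) b13 (ball_nonneg3 4 7 hκ hκ1) b14 c1 c2 c3 c4 c5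
  rcases le_or_gt κ (75 / 28) with hE | hE
  · obtain ⟨b1, b2, b3, b4, b5, b6, b7, b8, b9, b10, b11, b12, b13, b14⟩ := piece_brackets_qe hD.le hE
    obtain ⟨-, -, c1, c2, c3, c4, c5⟩ := cancel_piece_qe hD.le hE hZl hZu hZpl hZpu hBl hBu
    exact cert_arith_qe hD.le hE b1 b2 b3 b4 b5 b6 hm2l b7 b8 b9 b10 b11 (ball_nonneg3 2 7 hκ hκ1) b12
      (ball_nonneg3 3 6 hκ hκ1) b13 (ball_nonneg3 4 7 hκ hκ1) b14 c1 c2 c3 c4 c5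
  rcases le_or_gt κ (11 / 4) with hF | hF
  · obtain ⟨b1, b2, b3, b4, b5, b6, b7, b8, b9, b10, b11, b12, b13, b14⟩ := piece_brackets_qf hE.le hF
    obtain ⟨-, -, c1, c2, c3, c4, c5⟩ := cancel_piece_qf hE.le hF hZl hZu hZpl hZpu hBl hBu
    exact cert_arith_qf hE.le hF b1 b2 b3 b4 b5 b6 hm2l b7 b8 b9 b10 b11 (ball_nonneg3 2 7 hκ hκ1) b12
      (ball_nonneg3 3 6 hκ hκ1) b13 (ball_nonneg3 4 7 hκ hκ1) b14 c1 c2 c3 c4 c5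
  rcases le_or_gt κ (79 / 28) with hG | hG
  · obtain ⟨b1, b2, b3, b4, b5, b6, b7, b8, b9, b10, b11, b12, b13, b14⟩ := piece_brackets_qg hF.le hG
    obtain ⟨-, -, c1, c2, c3, c4, c5⟩ := cancel_piece_qg hF.le hG hZl hZu hZpl hZpu hBl hBu
    exact cert_arith_qg hF.le hG b1 b2 b3 b4 b5 b6 hm2l b7 b8 b9 b10 b11 (ball_nonneg3 2 7 hκ hκ1) b12
      (ball_nonneg3 3 6 hκ hκ1) b13 (ball_nonneg3 4 7 hκ hκ1) b14 c1 c2 c3 c4 c5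
  rcases le_or_gt κ (81 / 28) with hH | hH
  · obtain ⟨b1, b2, b3, b4, b5, b6, b7, b8, b9, b10, b11, b12, b13, b14⟩ := piece_brackets_qh hG.le hH
    obtain ⟨-, -, c1, c2, c3, c4, c5⟩ := cancel_piece_qh hG.le hH hZl hZu hZpl hZpu hBl hBu
    exact cert_arith_qh hG.le hH b1 b2 b3 b4 b5 b6 hm2l b7 b8 b9 b10 b11 (ball_nonneg3 2 7 hκ hκ1) b12
      (ball_nonneg3 3 6 hκ hκ1) b13 (ball_nonneg3 4 7 hκ hκ1) b14 c1 c2 c3 c4 c5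
  rcases le_or_gt κ (83 / 28) with hI | hI
  · obtain ⟨b1, b2, b3, b4, b5, b6, b7, b8, b9, b10, b11, b12, b13, b14⟩ := piece_brackets_qi hH.le hI
    obtain ⟨-, -, c1, c2, c3, c4, c5⟩ := cancel_piece_qi hH.le hI hZl hZu hZpl hZpu hBl hBu
    exact cert_arith_qi hH.le hI b1 b2 b3 b4 b5 b6 hm2l b7 b8 b9 b10 b11 (ball_nonneg3 2 7 hκ hκ1) b12
      (ball_nonneg3 3 6 hκ hκ1) b13 (ball_nonneg3 4 7 hκ hκ1) b14 c1 c2 c3 c4 c5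
  obtain ⟨b1, b2, b3, b4, b5, b6, b7, b8, b9, b10, b11, b12, b13, b14⟩ := piece_brackets_qj hI.le hκ1
  obtain ⟨-, -, c1, c2, c3, c4, c5⟩ := cancel_piece_qj hI.le hκ1 hZl hZu hZpl hZpu hBl hBu
  exact cert_arith_qj hI.le hκ1 b1 b2 b3 b4 b5 b6 hm2l b7 b8 b9 b10 b11 (ball_nonneg3 2 7 hκ hκ1) b12
    (ball_nonneg3 3 6 hκ hκ1) b13 (ball_nonneg3 4 7 hκ hκ1) b14 c1 c2 c3 c4 c5

end Summit.Ventures.YMGap.BallCertificateThree
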